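import Mathlib.Analysis.SpecialFunctions.Pow.Real
import Mathlib.Analysis.PSeries
import Literature.Geometry.MetricEmbeddings.HeisenbergL1NaorYoung
import HarnessLib

/-!
# The horizontal and vertical edge boundaries of Naor–Young on the discrete Heisenberg group `ℍ_ℤ³`,
and the Cheeger–Kleiner–Naor bound from the (endpoint, `q = 4`) vertical-versus-horizontal
isoperimetric inequality stated with them

Family `pnp`, layer `Literature/Geometry/MetricEmbeddings`. Consumer: the Naor–Young route to
`CheegerKleinerNaor2011_wordBall_l1Distortion` (`HeisenbergL1.lean`): the `L₁`-distortion of the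
word ball `𝔅_n ⊂ ℍ_ℤ³` is `≳ (log n)^{1/4}` BECAUSE of the isoperimetric-type inequality below
(A. Naor, R. Young, *Foliated corona decompositions*, Acta Math. 229 (2022) §1.1.1, arXiv:2004.12522
p. 5: "for any `p ≥ 1`, if every compactly supported smooth function `f : ℝ³ → ℝ` satisfies the
inequality (1.7) then by [NY18] and the reasoning in [NY18] we have `c_{ℓ₁}(𝓑_n) ≳ (log n)^{1/p}`.
Thus, `c_{ℓ₁}(𝓑_n) ≳ ⁴√(log n)`, since Theorem 1.1 asserts that (1.7) holds for `p = 4`.").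
Sources read, verbatim:

* A. Naor, R. Young, *Vertical perimeter versus horizontal perimeter*, Ann. of Math. 188 (2018)
  171–279 = arXiv:1701.00620, §1 (arXiv pp. 3–4). The group: "the `k`'th discrete Heisenberg group,
  denoted `ℍ_ℤ^{2k+1}`, is defined via generators and relations […] `a_1,b_1,…,a_k,b_k,c` […]
  `c = [a_1,b_1] = … = [a_k,b_k]` and `[a_i,a_j]=[b_i,b_j]=[a_i,b_j]=[a_i,c]=[b_i,c]=1` […] The set
  `𝔖_k = {a_1,b_1,a_1^{-1},b_1^{-1},…}` is a symmetric generating subset […] A standard concrete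
  realization of `ℍ_ℤ^{2k+1}` is the group of all `k+2` by `k+2` matrices with integer entries of the
  following form" (upper unitriangular; for `k = 1` this is EXACTLY `heisMul` of `HeisenbergL1.lean`
  on `ℤ × ℤ × ℤ`, `(x,y,z)·(x',y',z') = (x+x', y+y', z+z'+xy')`, `a = (1,0,0)`, `b = (0,1,0)`,
  `c = [a,b] = (0,0,1)`, `commutator_genA_genB` below). **Definition 1.1 (Discrete boundaries).**
  "Given `Ω ⊂ ℍ_ℤ^{2k+1}`, the horizontal boundary of `Ω` is defined by
  `∂_h Ω ≝ {(x,y) ∈ Ω × (ℍ_ℤ^{2k+1} ∖ Ω) : x⁻¹y ∈ 𝔖_k}`. Given also `t ∈ ℕ`, the `t`-vertical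
  boundary of `Ω` is defined by `∂ᵗ_v Ω ≝ {(x,y) ∈ Ω × (ℍ_ℤ^{2k+1} ∖ Ω) : x⁻¹y ∈ {cᵗ, c⁻ᵗ}}`. The
  horizontal perimeter of `Ω` is defined to be the cardinality `|∂_h Ω|`". Theorem 1.3 (`k ≥ 2`):
  `|∂_v Ω| ≲ |∂_h Ω|/k` with `|∂_v Ω| = (Σ_{t≥1} |∂ᵗ_vΩ|²/t²)^{1/2}`, and the Remark following it:
  "Note the restriction `k ≥ 2` […] ongoing work shows that Theorem 1.3 fails for `k = 1`, but that
  there exists `q ∈ (2,∞)` such that for every `Ω ⊂ ℍ_ℤ³` we have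
  `(Σ_{t=1}^∞ |∂ᵗ_v Ω|^q / t^{1+q/2})^{1/q} ≲ |∂_h Ω|` […] with ongoing work indicating that
  [the infimum over those `q`] is at least `4`." (Remark 1.4 in the arXiv numbering: Def. 1.1 =
  discrete boundaries, Thm. 1.3 = the discrete theorem; we cite these items by that numbering AND by
  name). §3.1, Lemma 3.1 ("From sets to functions", general `k`, weights `w_t`, exponent `q`) and
  §3.2, Lemma 3.6 ("From continuous to discrete": a Sobolev-type inequality for
  smooth compactly supported functions on `ℍ^{2k+1}` implies its discrete counterpart on `ℍ_ℤ^{2k+1}`;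
  general `k ∈ ℕ`, weight `𝒲`, exponents `p ≥ 1`, `q`) — arXiv pp. 19–23.
* A. Naor, R. Young, *Foliated corona decompositions*, Acta Math. 229 (2022) 55–200 =
  arXiv:2004.12522, **Theorem 1.1**: "Every compactly supported smooth function `f : ℝ³ → ℝ`
  satisfies `(∫_0^∞ (∫_{ℝ³} |D_v^t f(h)| dh)^4 dt/t)^{1/4} ≲ ∫_{ℝ³} (|Xf(h)| + |Yf(h)|) dh`"
  (`D_v^t f(h) = (f(x,y,z+t) − f(h))/√t`; `X, Y` the horizontal vector fields), i.e. inequality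
  (1.7) with `p = 4`; by Lemma 3.6 of [NY18] (with `k = 1`, `𝒲(s) = s^{-3}`, `p = 1`, `q = 4`,
  `X = ℝ`) and (the trivial direction of) Lemma 3.1 of [NY18] this is the case `q = 4` of the
  discrete display of Remark 1.4 above (arXiv p. 5, quoted at the top).

## What is here

* `centerPow t = cᵗ = (0,0,t)`, `heisMul_centerPow` (`g·cᵗ = (x, y, z+t)`), `commutator_genA_genB`
  (`c = a b a⁻¹ b⁻¹`); the symmetric generating set `horizontalGens = 𝔖₁ = {a, a⁻¹, b, b⁻¹}`;
* `hBoundary Ω = ∂_h Ω` and `vBoundary t Ω = ∂ᵗ_v Ω` as `Finset`s of ordered pairs, LITERALLY the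
  printed sets (`x⁻¹y = σ ⟺ y = x·σ`), with membership lemmas `mem_hBoundary`, `mem_vBoundary` and
  the crude bounds `card_hBoundary_le` (`≤ 4|Ω|`), `card_vBoundary_le` (`≤ 2|Ω|`);
* PROVED: `card_hBoundary`, `card_vBoundary` (the printed pair sets have the counted cardinalities
  `#{(x,σ) ∈ Ω × 𝔖₁ : x·σ ∉ Ω}` and `#{x ∈ Ω : x·cᵗ ∉ Ω} + #{x ∈ Ω : x·c⁻ᵗ ∉ Ω}` used in
  `HeisenbergL1NaorYoung.lean`), `summable_vBoundary` (the vertical-perimeter series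
  `Σ_{t≥1} |∂ᵗ_v Ω|⁴/t³` converges for finite `Ω`), and
  `CheegerKleinerNaor2011_wordBall_l1Distortion.of_vBoundary_hBoundary`: IF there is a universal
  `C` with `(Σ_{t=1}^∞ |∂ᵗ_v Ω|⁴ / t³)^{1/4} ≤ C |∂_h Ω|` for every finite `Ω ⊂ ℍ_ℤ³` — the display
  of [NY18, Rem. 1.4] with `q = 4` (`1 + q/2 = 3`), established in [NY22, Thm. 1.1, §1.1.1] — THEN
  the vendored [CKN, Cor. 1.2] `CheegerKleinerNaor2011_wordBall_l1Distortion` holds (with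
  `δ = 1/4`; the work is `CheegerKleinerNaor2011_wordBall_l1Distortion.of_verticalVsHorizontal` of
  `HeisenbergL1NaorYoung.lean`, here restated on the first-class boundaries).

Not here: the isoperimetric inequality itself as a named fact or theorem (XL: intrinsic Lipschitz
graphs, foliated corona decompositions — the whole of [NY22] §§2–6 — plus the discretization
Lemma 3.6 of [NY18]); the `ℓ₂` theorem of [NY18] for `ℍ_ℤ^{2k+1}`, `k ≥ 2`; the continuous
Heisenberg group.

## References

* [NaorYoung2018] A. Naor, R. Young, Ann. of Math. 188 (2018) 171–279, §1 Def. 1.1 (discrete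
  boundaries), Thm. 1.3 and Remark 1.4 after it (the `k = 1` display with exponent `q`); §3.1
  Lemma 3.1 (sets to functions), §3.2 Lemma 3.6 (continuous to discrete) — arXiv:1701.00620
  pp. 3–4, 19–23; item numbers as in the arXiv version.
* [NaorYoung2022] A. Naor, R. Young, Acta Math. 229 (2022) 55–200, Thm. 1.1 and §1.1.1
  (arXiv:2004.12522 pp. 3–5).
-/

noncomputable section

open Finset

namespace Literature.Geometry.MetricEmbeddings

/-! ### The centre, the generators and the two edge boundaries -/

/-- The central element `cᵗ = (0, 0, t)` of `ℍ(ℤ)` (`c = [a, b] = (0, 0, 1)` generates the centre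
`{0} × {0} × ℤ`). [cite: NaorYoung2018, §1] -/
def centerPow (t : ℤ) : ℤ × ℤ × ℤ := (0, 0, t)

/-- Right multiplication by `cᵗ` is the vertical shift `(x, y, z) ↦ (x, y, z + t)`.
[cite: NaorYoung2018, §1] -/
@[simp]
theorem heisMul_centerPow (g : ℤ × ℤ × ℤ) (t : ℤ) :
    heisMul g (centerPow t) = (g.1, g.2.1, g.2.2 + t) := by
  simp [heisMul, centerPow]

/-- `c = [a, b] = a b a⁻¹ b⁻¹ = (0, 0, 1)` in the model `heisMul` (`a⁻¹ = (-1,0,0)`,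
`b⁻¹ = (0,-1,0)`): the defining relation of `ℍ_ℤ³ = ⟨a, b, c | c = [a,b] central⟩`.
[cite: NaorYoung2018, §1] -/
theorem commutator_genA_genB :
    heisMul (heisMul (heisMul genA genB) (-1, 0, 0)) (0, -1, 0) = centerPow 1 := by
  simp [heisMul, genA, genB, centerPow]

/-- `a · a⁻¹ = 1` and `b · b⁻¹ = 1` for `a⁻¹ = (-1,0,0)`, `b⁻¹ = (0,-1,0)`. [cite: NaorYoung2018, §1] -/
theorem heisMul_gen_inv :
    heisMul genA (-1, 0, 0) = (0, 0, 0) ∧ heisMul genB (0, -1, 0) = (0, 0, 0) := by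
  simp [heisMul, genA, genB]

/-- The symmetric horizontal generating set `𝔖₁ = {a, a⁻¹, b, b⁻¹}` of `ℍ_ℤ³`.
[cite: NaorYoung2018, §1] -/
def horizontalGens : Finset (ℤ × ℤ × ℤ) := {(1, 0, 0), (-1, 0, 0), (0, 1, 0), (0, -1, 0)}

/-- `𝔖₁` has (at most) four elements. [cite: NaorYoung2018, §1] -/
theorem card_horizontalGens_le : horizontalGens.card ≤ 4 := by
  unfold horizontalGens
  refine (card_insert_le _ _).trans ?_
  refine Nat.succ_le_succ ((card_insert_le _ _).trans ?_)
  refine Nat.succ_le_succ ((card_insert_le _ _).trans ?_)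
  simp

/-- **The horizontal boundary** `∂_h Ω = {(x, y) ∈ Ω × (ℍ_ℤ³ ∖ Ω) : x⁻¹y ∈ 𝔖₁}` of a finite
`Ω ⊂ ℍ_ℤ³` (ordered pairs; `x⁻¹y = σ ⟺ y = x·σ`): the edge boundary of `Ω` in the Cayley graph of
`𝔖₁`. Its cardinality is the horizontal perimeter `|∂_h Ω|`. [cite: NaorYoung2018, §1 Def. 1.1] -/
def hBoundary (Ω : Finset (ℤ × ℤ × ℤ)) : Finset ((ℤ × ℤ × ℤ) × (ℤ × ℤ × ℤ)) :=
  ((Ω ×ˢ horizontalGens).image fun p => (p.1, heisMul p.1 p.2)).filter fun q => q.2 ∉ Ω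

/-- **The `t`-vertical boundary** `∂ᵗ_v Ω = {(x, y) ∈ Ω × (ℍ_ℤ³ ∖ Ω) : x⁻¹y ∈ {cᵗ, c⁻ᵗ}}` of a
finite `Ω ⊂ ℍ_ℤ³` (ordered pairs; `y = x·c^{±t} = (x₁, x₂, x₃ ± t)`).
[cite: NaorYoung2018, §1 Def. 1.1] -/
def vBoundary (t : ℕ) (Ω : Finset (ℤ × ℤ × ℤ)) : Finset ((ℤ × ℤ × ℤ) × (ℤ × ℤ × ℤ)) :=
  ((Ω ×ˢ ({(t : ℤ), -(t : ℤ)} : Finset ℤ)).image fun p => (p.1, heisMul p.1 (centerPow p.2))).filter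
    fun q => q.2 ∉ Ω

/-- Membership in the horizontal boundary: `(x, y) ∈ ∂_h Ω ⟺ x ∈ Ω ∧ y ∉ Ω ∧ y = x·σ` for some
`σ ∈ 𝔖₁`. [cite: NaorYoung2018, §1 Def. 1.1] -/
theorem mem_hBoundary {Ω : Finset (ℤ × ℤ × ℤ)} {q : (ℤ × ℤ × ℤ) × (ℤ × ℤ × ℤ)} :
    q ∈ hBoundary Ω ↔ q.1 ∈ Ω ∧ q.2 ∉ Ω ∧ ∃ σ ∈ horizontalGens, q.2 = heisMul q.1 σ := by
  simp only [hBoundary, mem_filter, mem_image, mem_product]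
  constructor
  · rintro ⟨⟨p, ⟨hp1, hp2⟩, hpq⟩, hq⟩
    subst hpq
    exact ⟨hp1, hq, p.2, hp2, rfl⟩
  · rintro ⟨hx, hy, σ, hσ, hq2⟩
    refine ⟨⟨(q.1, σ), ⟨hx, hσ⟩, ?_⟩, hy⟩
    obtain ⟨x, y⟩ := q
    simp only at hq2 ⊢
    rw [hq2]

/-- Membership in the `t`-vertical boundary: `(x, y) ∈ ∂ᵗ_v Ω ⟺ x ∈ Ω ∧ y ∉ Ω ∧ y = x·c^{±t}`.
[cite: NaorYoung2018, §1 Def. 1.1] -/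
theorem mem_vBoundary {t : ℕ} {Ω : Finset (ℤ × ℤ × ℤ)} {q : (ℤ × ℤ × ℤ) × (ℤ × ℤ × ℤ)} :
    q ∈ vBoundary t Ω ↔ q.1 ∈ Ω ∧ q.2 ∉ Ω ∧
      (q.2 = (q.1.1, q.1.2.1, q.1.2.2 + t) ∨ q.2 = (q.1.1, q.1.2.1, q.1.2.2 - t)) := by
  simp only [vBoundary, mem_filter, mem_image, mem_product, mem_insert, mem_singleton]
  constructor
  · rintro ⟨⟨p, ⟨hp1, hp2⟩, hpq⟩, hq⟩
    subst hpq
    refine ⟨hp1, hq, ?_⟩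
    rcases hp2 with h | h
    · left
      rw [heisMul_centerPow, h]
    · right
      rw [heisMul_centerPow, h, sub_eq_add_neg]
  · rintro ⟨hx, hy, h⟩
    rcases h with h | h
    · refine ⟨⟨(q.1, (t : ℤ)), ⟨hx, Or.inl rfl⟩, ?_⟩, hy⟩
      obtain ⟨x, y⟩ := q
      simp only at h ⊢
      rw [h, heisMul_centerPow]
    · refine ⟨⟨(q.1, -(t : ℤ)), ⟨hx, Or.inr rfl⟩, ?_⟩, hy⟩
      obtain ⟨x, y⟩ := q
      simp only at h ⊢
      rw [h, heisMul_centerPow, sub_eq_add_neg]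

/-- `|∂_h Ω| ≤ 4 |Ω|`. [cite: NaorYoung2018, §1 Def. 1.1] -/
theorem card_hBoundary_le (Ω : Finset (ℤ × ℤ × ℤ)) : (hBoundary Ω).card ≤ 4 * Ω.card := by
  calc (hBoundary Ω).card ≤ ((Ω ×ˢ horizontalGens).image fun p => (p.1, heisMul p.1 p.2)).card :=
        card_filter_le _ _
    _ ≤ (Ω ×ˢ horizontalGens).card := card_image_le
    _ = Ω.card * horizontalGens.card := card_product _ _
    _ ≤ Ω.card * 4 := Nat.mul_le_mul_left _ card_horizontalGens_le
    _ = 4 * Ω.card := by ring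

/-- `|∂ᵗ_v Ω| ≤ 2 |Ω|`. [cite: NaorYoung2018, §1 Def. 1.1] -/
theorem card_vBoundary_le (t : ℕ) (Ω : Finset (ℤ × ℤ × ℤ)) : (vBoundary t Ω).card ≤ 2 * Ω.card := by
  calc (vBoundary t Ω).card
      ≤ ((Ω ×ˢ ({(t : ℤ), -(t : ℤ)} : Finset ℤ)).image
          fun p => (p.1, heisMul p.1 (centerPow p.2))).card := card_filter_le _ _
    _ ≤ (Ω ×ˢ ({(t : ℤ), -(t : ℤ)} : Finset ℤ)).card := card_image_le
    _ = Ω.card * ({(t : ℤ), -(t : ℤ)} : Finset ℤ).card := card_product _ _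
    _ ≤ Ω.card * 2 := Nat.mul_le_mul_left _ (card_le_two)
    _ = 2 * Ω.card := by ring

/-! ### The counted cardinalities and the Cheeger–Kleiner–Naor bound -/

/-- `|∂_h Ω| = #{(x, σ) ∈ Ω × 𝔖₁ : x·σ ∉ Ω}` (the pair `(x, x·σ)` is determined by `(x, σ)`).
[cite: NaorYoung2018, §1 Def. 1.1] -/
theorem card_hBoundary (Ω : Finset (ℤ × ℤ × ℤ)) :
    (hBoundary Ω).card = ((Ω ×ˢ horizontalGens).filter fun p => heisMul p.1 p.2 ∉ Ω).card := by
  unfold hBoundary horizontalGens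
  exact CheegerKleinerNaor2011_wordBall_l1Distortion.card_hBoundaryPairs Ω

/-- `|∂ᵗ_v Ω| = #{x ∈ Ω : x·cᵗ ∉ Ω} + #{x ∈ Ω : x·c⁻ᵗ ∉ Ω}` for `t ≥ 1` (the pairs `(x, x·cᵗ)` and
`(x, x·c⁻ᵗ)` are distinct and determined by `x`). [cite: NaorYoung2018, §1 Def. 1.1] -/
theorem card_vBoundary {t : ℕ} (ht : 1 ≤ t) (Ω : Finset (ℤ × ℤ × ℤ)) :
    (vBoundary t Ω).card = (Ω.filter fun x => (x.1, x.2.1, x.2.2 + (t : ℤ)) ∉ Ω).card +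
      (Ω.filter fun x => (x.1, x.2.1, x.2.2 - (t : ℤ)) ∉ Ω).card := by
  unfold vBoundary centerPow
  exact CheegerKleinerNaor2011_wordBall_l1Distortion.card_vBoundaryPairs (by omega) Ω

/-- The vertical-perimeter series `Σ_{t≥1} |∂ᵗ_v Ω|⁴/t³` converges for finite `Ω`
(terms `≤ (2|Ω|)⁴/t³`). [cite: NaorYoung2018, §1 Def. 1.1] -/
theorem summable_vBoundary (Ω : Finset (ℤ × ℤ × ℤ)) :
    Summable fun t : ℕ => ((vBoundary (t + 1) Ω).card : ℝ) ^ 4 / ((t : ℝ) + 1) ^ 3 := by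
  have h3 : Summable fun t : ℕ => 1 / ((t : ℝ) + 1) ^ 3 := by
    have h := (summable_nat_add_iff 1).mpr (Real.summable_one_div_nat_pow.mpr (by norm_num : 1 < 3))
    simpa using h
  refine (h3.mul_left ((2 * (Ω.card : ℝ)) ^ 4)).of_nonneg_of_le (fun t => by positivity) fun t => ?_
  have hc : ((vBoundary (t + 1) Ω).card : ℝ) ≤ 2 * Ω.card := by
    exact_mod_cast card_vBoundary_le (t + 1) Ω
  have hpos : (0 : ℝ) < ((t : ℝ) + 1) ^ 3 := by positivity
  rw [mul_one_div]
  exact div_le_div_of_nonneg_right (pow_le_pow_left₀ (by positivity) hc 4) hpos.le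

/-- **The Cheeger–Kleiner–Naor bound from the Naor–Young isoperimetric inequality, stated on the
boundaries `∂_h`, `∂ᵗ_v` of [NY18, Def. 1.1].** If there is a universal `C` with
`(Σ_{t=1}^∞ |∂ᵗ_v Ω|⁴ / t³)^{1/4} ≤ C · |∂_h Ω|` for every finite `Ω ⊂ ℍ_ℤ³` — the display of
[NY18, Rem. 1.4] ("there exists `q ∈ (2,∞)` such that for every `Ω ⊂ ℍ_ℤ³` we have
`(Σ_{t=1}^∞ |∂ᵗ_vΩ|^q / t^{1+q/2})^{1/q} ≲ |∂_hΩ|`") in the case `q = 4`, which [NY22, §1.1.1]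
obtains from the continuous `L₄` inequality [NY22, Thm. 1.1] through Lemmas 3.6 and 3.1 of [NY18] —
then `CheegerKleinerNaor2011_wordBall_l1Distortion` ([CKN, Cor. 1.2] as vendored in
`HeisenbergL1.lean`) holds. (`of_verticalVsHorizontal_pairs` with `card_hBoundary`,
`card_vBoundary`.) [cite: NaorYoung2022, Thm. 1.1 and §1.1.1] [cite: NaorYoung2018, §1 Def. 1.1, Rem. 1.4] -/
theorem CheegerKleinerNaor2011_wordBall_l1Distortion.of_vBoundary_hBoundary
    (hX : ∃ C : ℝ, 0 < C ∧ ∀ Ω : Finset (ℤ × ℤ × ℤ),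
      (∑' t : ℕ, ((vBoundary (t + 1) Ω).card : ℝ) ^ 4 / ((t : ℝ) + 1) ^ 3) ^ (1 / 4 : ℝ) ≤
        C * (hBoundary Ω).card) :
    CheegerKleinerNaor2011_wordBall_l1Distortion := by
  refine CheegerKleinerNaor2011_wordBall_l1Distortion.of_verticalVsHorizontal ?_
  obtain ⟨C, hC, H⟩ := hX
  refine ⟨C, hC, fun Ω => ?_⟩
  have h := H Ω
  have ev : ∀ t : ℕ, ((vBoundary (t + 1) Ω).card : ℝ) =
      ((Ω.filter fun x => (x.1, x.2.1, x.2.2 + ((t : ℤ) + 1)) ∉ Ω).card : ℝ) +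
        ((Ω.filter fun x => (x.1, x.2.1, x.2.2 - ((t : ℤ) + 1)) ∉ Ω).card : ℝ) := by
    intro t
    rw [card_vBoundary (by omega) Ω]
    push_cast
    rfl
  simp_rw [ev] at h
  rw [card_hBoundary] at h
  exact h


end Literature.Geometry.MetricEmbeddings

end
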